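import Summits.CriticalPhenomena.PercolationContinuityZ3.Theorems.Transplant.KNParaChainAppendNP
import HarnessLib

/-!
# N2 (frames-only node `SamePDropOfSkeletonFrm₁`, OPEN), LEVEL 1, (C) column: THE THREE-PHASE K-G CORRIDOR AS ONE SCHEDULE WITH PARKING —
# `ChainPara.corrSchedNP` := [the run `R` along axis `a` (`RunPrm.scheduleN….toNPρ`)] ⧺ [the ACROSS-parking `P₁` along `a′ = oth a`, started on the
# run's last core] ⧺ [the ALONG-parking `P₂` along `a`, started on `P₁`'s last core] — ONE planar frame, ONE sign `σ`, three origins `c, c₁, c₂`,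
# glued by `ScheduleNP.appendNP` (KNParaChainAppendNP) at two EXACT core identities; pure `Site 2` / `ℤ`.

builds on p205010 (kernel theorem, internal audit signed; external expert review pending) — nothing in this file uses p205010; nothing here is a
claim about the open node `SamePDropOfSkeletonFrm₁`.
Lane `prim-bschramm`, seat `prim-bschramm-p5` (gen 15; (C) lineage); helper file (`--supports stmt-CriticalPhenomena-4575`).
DESIGN OF RECORD ((R-22) K-G, lane INBOX 2026-08-22T19:08:04Z / 19:27:51Z; HOME/prim-bschramm-p5-g15/B9-CORRIDOR-BOX.md §2, §A3): under orientation a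
corridor has no two-signed localisation rounds (LEMMA B9), so it is [forward E-run] ⧺ [parking across] ⧺ [parking along]; the y′-frame of a run origin
is the x-frame with the coordinates exchanged (`Skelφ.runY = swap ∘ Skelφ.runX`, SkelPhiParaRunFrame :81–:86), so all three phases live in ONE frame and
ONE `ScheduleNP` — no cross-frame link.  WHY THE ORDER across-then-along: the last phase's transverse growth `2·m·g` enters the arrival box
uncorrected; parking ACROSS first makes that growth second-order (`m₂ ∝` the across-phase's growth, not the run's spread).
* §1 `ScheduleN.toNPρ` (a slab-target schedule as a schedule with parking at ANY zone radius `ρ` — the stride branch everywhere), `toNPρ_spec/_core`;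
* §2 `dBox_swap_eq` (a doubly-signed box on axis `a′ = oth a` equals one on axis `a` iff the four edge equations hold), `ParkPrm.pcore_zero`,
  **`park_core_zero_eq_run_core`**, **`park_core_zero_eq_park_core`** (the two joins from four edge equations each);
* §3 **`corrSchedNP`**, `corrSchedNP_params`, `corrSchedNP_core_run/_park₁/_park₂` (+ regions, axes), `corrSchedNP_core_zero/_last`,
  `mem_corrSchedNP_core_zero/_last`, `corrSchedNP_region_subset`;
* §4 **`corrSchedNP_core_last_subset`**: after `m₂ + 1` along-parking steps with `A₂ − aLo0₂ ≤ sHi₂ + ρ − 1 + (m₂+1)(sLo₂ − 2ea₂ − ρ)` the LAST core lies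
  in the explicit box `[aHi₂(m₂+1) − (sHi₂ + ρ − 1), aHi₂(m₂+1)] × [−Wm₂ − (m₂+1)g₂, Wp₂ + (m₂+1)g₂]` about `c₂` — the numbers the Geom pen needs to
  place the staggered arrival cube `PCells2S.Mb b₀ (v + du)` (creep and `b₀` slots).
[cite: KozmaNitzan2024, §4 Lemma 11 (pp. 22–23), Lemma 12 (pp. 23–25: arrival in the target box)]
[cite: MartineauTassion2017, §4.3 Lemma 4.2 (piece choice by position; arXiv:1312.1946 pp. 12–14)]
-/

noncomputable section

namespace Summit.CriticalPhenomena.PercolationContinuityZ3.Theorems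

namespace Transplant

namespace ChainPlanar

open Literature.Probability.Percolation Literature.Probability.LatticeModels
open Literature.Probability.Percolation.KozmaNitzan
open Literature.Probability.Percolation.KozmaNitzan.Cells (oth oth_ne eq_oth_of_ne oth_oth)

/-! ## §1 A slab-target schedule as a schedule with parking at any zone radius -/

/-- **A schedule with slab targets is a schedule with parking at ANY zone radius `ρ`** (the stride branch everywhere; `toNP` is `toNPρ 0`).
[folklore] -/
def ScheduleN.toNPρ (S : ScheduleN) (ρ : ℕ) : ScheduleNP where
  ax := S.ax
  lo := S.lo
  hi := S.hi
  region := S.region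
  prism := S.prism
  N := S.N
  R' := S.R'
  ρ := ρ
  sLo := S.sLo
  sHi := S.sHi
  d := S.d
  Pp := S.Pp
  Pm := S.Pm
  La := S.La
  Lb := S.Lb
  encl := S.encl
  succ := S.succ
  sub_prism := S.sub_prism
  nonempty := S.nonempty
  routeP k hk v hv := by
    obtain ⟨σ, hσ, hreg, τ, hτ, hroute⟩ := S.route k hk v hv
    exact ⟨σ, hσ, hreg, Or.inr ⟨τ, hτ, hroute⟩⟩

/-- The geometric fields of `toNPρ` are those of the schedule; the zone radius is `ρ`. [folklore] -/
theorem ScheduleN.toNPρ_spec (S : ScheduleN) (ρ : ℕ) :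
    (S.toNPρ ρ).ax = S.ax ∧ (S.toNPρ ρ).lo = S.lo ∧ (S.toNPρ ρ).hi = S.hi ∧ (S.toNPρ ρ).region = S.region ∧ (S.toNPρ ρ).prism = S.prism ∧
      (S.toNPρ ρ).N = S.N ∧ (S.toNPρ ρ).R' = S.R' ∧ (S.toNPρ ρ).ρ = ρ := ⟨rfl, rfl, rfl, rfl, rfl, rfl, rfl, rfl⟩

/-- The cores of `toNPρ` are the cores of the schedule. [folklore] -/
theorem ScheduleN.toNPρ_core (S : ScheduleN) (ρ k : ℕ) : ScheduleNP.core (S.toNPρ ρ) k = S.core k := rfl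

/-- The levels of `toNPρ` are the levels of the schedule. [folklore] -/
theorem ScheduleN.toNPρ_level (S : ScheduleN) (ρ k j : ℕ) : ScheduleNP.level (S.toNPρ ρ) k j = S.level k j := rfl

/-! ## §2 Joining boxes across an axis exchange -/

/-- **A doubly-signed box on the exchanged axis**: the box on axis `oth a` about `c'` with edges `(aLo', aHi', bLo', bHi')` IS the box on axis `a`
about `c` with edges `(aLo, aHi, bLo, bHi)` when `aLo' = bLo + σ(c_{a′} − c'_{a′})`, `aHi' = bHi + σ(c_{a′} − c'_{a′})`, `bLo' = aLo + σ(c_a − c'_a)`,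
`bHi' = aHi + σ(c_a − c'_a)` (`a′ = oth a`). [folklore] -/
theorem dBox_swap_eq {a : Fin 2} {σ : ℤ} (hσ : σ = 1 ∨ σ = -1) {c c' : Site 2} {aLo aHi bLo bHi aLo' aHi' bLo' bHi' : ℤ}
    (haLo : aLo' = bLo + σ * (c (oth a) - c' (oth a))) (haHi : aHi' = bHi + σ * (c (oth a) - c' (oth a)))
    (hbLo : bLo' = aLo + σ * (c a - c' a)) (hbHi : bHi' = aHi + σ * (c a - c' a)) :
    dBox (oth a) σ c' aLo' aHi' bLo' bHi' = dBox a σ c aLo aHi bLo bHi := by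
  ext y
  rw [mem_dBox_iff hσ, mem_dBox_iff hσ, oth_oth]
  have e1 : σ * (y (oth a) - c' (oth a)) = σ * (y (oth a) - c (oth a)) + σ * (c (oth a) - c' (oth a)) := by ring
  have e2 : σ * (y a - c' a) = σ * (y a - c a) + σ * (c a - c' a) := by ring
  rw [e1, e2, haLo, haHi, hbLo, hbHi]
  constructor
  · rintro ⟨⟨h1, h2⟩, h3, h4⟩; exact ⟨⟨by linarith, by linarith⟩, by linarith, by linarith⟩
  · rintro ⟨⟨h1, h2⟩, h3, h4⟩; exact ⟨⟨by linarith, by linarith⟩, by linarith, by linarith⟩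

end ChainPlanar

namespace ChainPara

open Literature.Probability.Percolation Literature.Probability.LatticeModels
open Literature.Probability.Percolation.KozmaNitzan.Cells (oth oth_ne eq_oth_of_ne oth_oth)
open ChainPlanar

/-- The first rendered core of a parking phase is the start box `[aLo0, A] × [−Wm, Wp]`. [folklore] -/
theorem ParkPrm.pcore_zero (P : ParkPrm) (a : Fin 2) (σ : ℤ) (c : Site 2) :
    P.pcore a σ c 0 = dBox a σ c P.aLo0 P.A (-(P.Wm : ℤ)) P.Wp := by
  show dBox a σ c (ParkPrm.aLo P 0) (P.aHi 0) (P.bLo 0) (P.bHi 0) = _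
  have h1 : ParkPrm.aLo P 0 = P.aLo0 := rfl
  have h2 : P.aHi 0 = P.A := by simp [ParkPrm.aHi]
  have h3 : P.bLo 0 = -(P.Wm : ℤ) := by simp [ParkPrm.bLo]
  have h4 : P.bHi 0 = P.Wp := by simp [ParkPrm.bHi]
  rw [h1, h2, h3, h4]

section Joins

variable {R : RunPrm} {P₁ P₂ : ParkPrm} {a : Fin 2} {σ : ℤ} (hσ : σ = 1 ∨ σ = -1) {c c₁ c₂ : Site 2}
  (hR : RunOK R) (heb : R.eb = R.ea) (hP₁ : ParkOK P₁) (heb₁ : P₁.eb = P₁.ea) (hP₂ : ParkOK P₂) (heb₂ : P₂.eb = P₂.ea)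

/-- **JOIN 1 (run → across-parking) from four edge equations**: the across-parking's start box on axis `oth a` about `c₁` IS the run's core `N + 1`
when `aLo0₁ = bLo_R(N+1) + σ(c_{a′} − c₁_{a′})`, `A₁ = bHi_R(N+1) + σ(c_{a′} − c₁_{a′})`, `−Wm₁ = aLo_R(N+1) + σ(c_a − c₁_a)`,
`Wp₁ = aHi_R(N+1) + σ(c_a − c₁_a)`. [cite: KozmaNitzan2024, §4 Lemma 12 (pp. 23–25)] -/
theorem park_core_zero_eq_run_core (ρ : ℕ)
    (h1 : P₁.aLo0 = R.bLo (R.N + 1) + σ * (c (oth a) - c₁ (oth a))) (h2 : P₁.A = R.bHi (R.N + 1) + σ * (c (oth a) - c₁ (oth a)))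
    (h3 : -(P₁.Wm : ℤ) = R.aLo (R.N + 1) + σ * (c a - c₁ a)) (h4 : (P₁.Wp : ℤ) = R.aHi (R.N + 1) + σ * (c a - c₁ a)) :
    ScheduleNP.core (P₁.scheduleNP (oth a) hσ c₁ hP₁ heb₁) 0 = ScheduleNP.core ((R.scheduleN a hσ c hR heb).toNPρ ρ) (R.N + 1) := by
  rw [ParkPrm.scheduleNP_core, ScheduleN.toNPρ_core, RunPrm.scheduleN_core, ParkPrm.pcore_zero]
  exact dBox_swap_eq hσ h1 h2 h3 h4

/-- **JOIN 2 (across-parking → along-parking) from four edge equations**: the along-parking's start box on axis `a` about `c₂` IS the across-parking's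
core `N₁ + 1` (axis `oth a`, about `c₁`) when `aLo0₂ = bLo₁(N₁+1) + σ(c₁_a − c₂_a)`, `A₂ = bHi₁(N₁+1) + σ(c₁_a − c₂_a)`,
`−Wm₂ = aLo₁(N₁+1) + σ(c₁_{a′} − c₂_{a′})`, `Wp₂ = aHi₁(N₁+1) + σ(c₁_{a′} − c₂_{a′})`. [cite: KozmaNitzan2024, §4 Lemma 12 (pp. 23–25)] -/
theorem park_core_zero_eq_park_core
    (h1 : P₂.aLo0 = P₁.bLo (P₁.N + 1) + σ * (c₁ a - c₂ a)) (h2 : P₂.A = P₁.bHi (P₁.N + 1) + σ * (c₁ a - c₂ a))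
    (h3 : -(P₂.Wm : ℤ) = ParkPrm.aLo P₁ (P₁.N + 1) + σ * (c₁ (oth a) - c₂ (oth a)))
    (h4 : (P₂.Wp : ℤ) = P₁.aHi (P₁.N + 1) + σ * (c₁ (oth a) - c₂ (oth a))) :
    ScheduleNP.core (P₂.scheduleNP a hσ c₂ hP₂ heb₂) 0 = ScheduleNP.core (P₁.scheduleNP (oth a) hσ c₁ hP₁ heb₁) (P₁.N + 1) := by
  rw [ParkPrm.scheduleNP_core, ParkPrm.scheduleNP_core, ParkPrm.pcore_zero]
  have e := dBox_swap_eq (a := oth a) (c := c₁) (c' := c₂) hσ (aLo := ParkPrm.aLo P₁ (P₁.N + 1)) (aHi := P₁.aHi (P₁.N + 1))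
    (bLo := P₁.bLo (P₁.N + 1)) (bHi := P₁.bHi (P₁.N + 1)) (aLo' := P₂.aLo0) (aHi' := P₂.A) (bLo' := -(P₂.Wm : ℤ)) (bHi' := P₂.Wp)
    (by rw [oth_oth]; exact h1) (by rw [oth_oth]; exact h2) h3 h4
  rw [oth_oth] at e
  exact e

end Joins

/-! ## §3 The three-phase corridor schedule -/

section Corridor

variable (R : RunPrm) (P₁ P₂ : ParkPrm) (a : Fin 2) {σ : ℤ} (hσ : σ = 1 ∨ σ = -1) (c c₁ c₂ : Site 2)
  (hR : RunOK R) (heb : R.eb = R.ea) (hP₁ : ParkOK P₁) (heb₁ : P₁.eb = P₁.ea) (hP₂ : ParkOK P₂) (heb₂ : P₂.eb = P₂.ea)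
  (hea₁ : P₁.ea = R.ea) (hea₂ : P₂.ea = R.ea) (hρ : P₂.ρ = P₁.ρ)
  (hj₁ : ScheduleNP.core (P₁.scheduleNP (oth a) hσ c₁ hP₁ heb₁) 0 = ScheduleNP.core ((R.scheduleN a hσ c hR heb).toNPρ P₁.ρ) (R.N + 1))
  (hj₂ : ScheduleNP.core (P₂.scheduleNP a hσ c₂ hP₂ heb₂) 0 = ScheduleNP.core (P₁.scheduleNP (oth a) hσ c₁ hP₁ heb₁) (P₁.N + 1))

/-- The first two phases: run ⧺ across-parking. [cite: KozmaNitzan2024, §4 Lemma 12 (pp. 23–25)] -/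
abbrev corrSchedNP₁₂ : ScheduleNP :=
  ((R.scheduleN a hσ c hR heb).toNPρ P₁.ρ).appendNP (P₁.scheduleNP (oth a) hσ c₁ hP₁ heb₁) hea₁ rfl hj₁

include hj₂ in
/-- The second join, restated at the end of the first two phases. [folklore] -/
theorem corrSchedNP₁₂_join :
    ScheduleNP.core (P₂.scheduleNP a hσ c₂ hP₂ heb₂) 0 =
      ScheduleNP.core (corrSchedNP₁₂ R P₁ a hσ c c₁ hR heb hP₁ heb₁ hea₁ hj₁) ((corrSchedNP₁₂ R P₁ a hσ c c₁ hR heb hP₁ heb₁ hea₁ hj₁).N + 1) := by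
  exact hj₂.trans (ScheduleNP.appendNP_core_last ((R.scheduleN a hσ c hR heb).toNPρ P₁.ρ) (P₁.scheduleNP (oth a) hσ c₁ hP₁ heb₁) hea₁ rfl hj₁).symm

/-- **THE THREE-PHASE K-G CORRIDOR SCHEDULE**: run `R` (axis `a`, origin `c`, zone radius `P₁.ρ`) ⧺ across-parking `P₁` (axis `oth a`, origin `c₁`)
⧺ along-parking `P₂` (axis `a`, origin `c₂`), one sign `σ`. [cite: KozmaNitzan2024, §4 Lemma 12 (pp. 23–25)] -/
def corrSchedNP : ScheduleNP :=
  (corrSchedNP₁₂ R P₁ a hσ c c₁ hR heb hP₁ heb₁ hea₁ hj₁).appendNP (P₂.scheduleNP a hσ c₂ hP₂ heb₂) hea₂ hρ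
    (corrSchedNP₁₂_join R P₁ P₂ a hσ c c₁ c₂ hR heb hP₁ heb₁ hP₂ heb₂ hea₁ hj₁ hj₂)

/-- Parameters: `N = N_R + 1 + N₁ + 1 + N₂`, `R' = ea`, `ρ = ρ₁`, prism = the union of the three rendered prisms. [folklore] -/
theorem corrSchedNP_params :
    (corrSchedNP R P₁ P₂ a hσ c c₁ c₂ hR heb hP₁ heb₁ hP₂ heb₂ hea₁ hea₂ hρ hj₁ hj₂).N = R.N + 1 + P₁.N + 1 + P₂.N ∧
    (corrSchedNP R P₁ P₂ a hσ c c₁ c₂ hR heb hP₁ heb₁ hP₂ heb₂ hea₁ hea₂ hρ hj₁ hj₂).R' = R.ea ∧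
    (corrSchedNP R P₁ P₂ a hσ c c₁ c₂ hR heb hP₁ heb₁ hP₂ heb₂ hea₁ hea₂ hρ hj₁ hj₂).ρ = P₁.ρ ∧
    (corrSchedNP R P₁ P₂ a hσ c c₁ c₂ hR heb hP₁ heb₁ hP₂ heb₂ hea₁ hea₂ hρ hj₁ hj₂).prism =
      R.pprism a σ c ∪ P₁.pprism (oth a) σ c₁ ∪ P₂.pprism a σ c₂ :=
  ⟨rfl, rfl, rfl, rfl⟩

/-- **Run phase** (`k ≤ N_R`): axis `a`, the run's region, levels and core. [folklore] -/
theorem corrSchedNP_run {k : ℕ} (hk : k ≤ R.N) :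
    (corrSchedNP R P₁ P₂ a hσ c c₁ c₂ hR heb hP₁ heb₁ hP₂ heb₂ hea₁ hea₂ hρ hj₁ hj₂).ax k = a ∧
    (corrSchedNP R P₁ P₂ a hσ c c₁ c₂ hR heb hP₁ heb₁ hP₂ heb₂ hea₁ hea₂ hρ hj₁ hj₂).region k = R.pregion a σ c k ∧
    (∀ i, (corrSchedNP R P₁ P₂ a hσ c c₁ c₂ hR heb hP₁ heb₁ hP₂ heb₂ hea₁ hea₂ hρ hj₁ hj₂).level k i = (R.scheduleN a hσ c hR heb).level k i) ∧
    (corrSchedNP R P₁ P₂ a hσ c c₁ c₂ hR heb hP₁ heb₁ hP₂ heb₂ hea₁ hea₂ hρ hj₁ hj₂).core k = R.pcore a σ c k := by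
  have hk' : k ≤ (corrSchedNP₁₂ R P₁ a hσ c c₁ hR heb hP₁ heb₁ hea₁ hj₁).N := by show k ≤ R.N + 1 + P₁.N; omega
  obtain ⟨hax, hreg, hlev, hcore, -⟩ := ScheduleNP.appendNP_left (corrSchedNP₁₂ R P₁ a hσ c c₁ hR heb hP₁ heb₁ hea₁ hj₁) (P₂.scheduleNP a hσ c₂ hP₂ heb₂) hea₂ hρ (corrSchedNP₁₂_join R P₁ P₂ a hσ c c₁ c₂ hR heb hP₁ heb₁ hP₂ heb₂ hea₁ hj₁ hj₂) hk'
  obtain ⟨hax₁, hreg₁, hlev₁, hcore₁, -⟩ := ScheduleNP.appendNP_left ((R.scheduleN a hσ c hR heb).toNPρ P₁.ρ) (P₁.scheduleNP (oth a) hσ c₁ hP₁ heb₁) hea₁ rfl hj₁ hk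
  refine ⟨?_, ?_, fun i => ?_, ?_⟩
  · show ((corrSchedNP₁₂ R P₁ a hσ c c₁ hR heb hP₁ heb₁ hea₁ hj₁).appendNP (P₂.scheduleNP a hσ c₂ hP₂ heb₂) hea₂ hρ (corrSchedNP₁₂_join R P₁ P₂ a hσ c c₁ c₂ hR heb hP₁ heb₁ hP₂ heb₂ hea₁ hj₁ hj₂)).ax k = a; rw [hax]; exact hax₁
  · show ((corrSchedNP₁₂ R P₁ a hσ c c₁ hR heb hP₁ heb₁ hea₁ hj₁).appendNP (P₂.scheduleNP a hσ c₂ hP₂ heb₂) hea₂ hρ (corrSchedNP₁₂_join R P₁ P₂ a hσ c c₁ c₂ hR heb hP₁ heb₁ hP₂ heb₂ hea₁ hj₁ hj₂)).region k = _; rw [hreg]; exact hreg₁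
  · show ((corrSchedNP₁₂ R P₁ a hσ c c₁ hR heb hP₁ heb₁ hea₁ hj₁).appendNP (P₂.scheduleNP a hσ c₂ hP₂ heb₂) hea₂ hρ (corrSchedNP₁₂_join R P₁ P₂ a hσ c c₁ c₂ hR heb hP₁ heb₁ hP₂ heb₂ hea₁ hj₁ hj₂)).level k i = _; rw [hlev i]; exact hlev₁ i
  · show ((corrSchedNP₁₂ R P₁ a hσ c c₁ hR heb hP₁ heb₁ hea₁ hj₁).appendNP (P₂.scheduleNP a hσ c₂ hP₂ heb₂) hea₂ hρ (corrSchedNP₁₂_join R P₁ P₂ a hσ c c₁ c₂ hR heb hP₁ heb₁ hP₂ heb₂ hea₁ hj₁ hj₂)).core k = _; rw [hcore]; exact hcore₁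

/-- **Across-parking phase** (step `N_R + 1 + j`, `j ≤ N₁`): axis `oth a`, `P₁`'s region, levels and core at `j`. [folklore] -/
theorem corrSchedNP_park₁ {j : ℕ} (hj : j ≤ P₁.N) :
    (corrSchedNP R P₁ P₂ a hσ c c₁ c₂ hR heb hP₁ heb₁ hP₂ heb₂ hea₁ hea₂ hρ hj₁ hj₂).ax (R.N + 1 + j) = oth a ∧
    (corrSchedNP R P₁ P₂ a hσ c c₁ c₂ hR heb hP₁ heb₁ hP₂ heb₂ hea₁ hea₂ hρ hj₁ hj₂).region (R.N + 1 + j) = P₁.pregion (oth a) σ c₁ j ∧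
    (∀ i, (corrSchedNP R P₁ P₂ a hσ c c₁ c₂ hR heb hP₁ heb₁ hP₂ heb₂ hea₁ hea₂ hρ hj₁ hj₂).level (R.N + 1 + j) i =
      (P₁.scheduleNP (oth a) hσ c₁ hP₁ heb₁).level j i) ∧
    (corrSchedNP R P₁ P₂ a hσ c c₁ c₂ hR heb hP₁ heb₁ hP₂ heb₂ hea₁ hea₂ hρ hj₁ hj₂).core (R.N + 1 + j) = P₁.pcore (oth a) σ c₁ j := by
  have hk' : R.N + 1 + j ≤ (corrSchedNP₁₂ R P₁ a hσ c c₁ hR heb hP₁ heb₁ hea₁ hj₁).N := by show R.N + 1 + j ≤ R.N + 1 + P₁.N; omega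
  obtain ⟨hax, hreg, hlev, hcore, -⟩ := ScheduleNP.appendNP_left (corrSchedNP₁₂ R P₁ a hσ c c₁ hR heb hP₁ heb₁ hea₁ hj₁) (P₂.scheduleNP a hσ c₂ hP₂ heb₂) hea₂ hρ (corrSchedNP₁₂_join R P₁ P₂ a hσ c c₁ c₂ hR heb hP₁ heb₁ hP₂ heb₂ hea₁ hj₁ hj₂) hk'
  obtain ⟨hax₁, hreg₁, hlev₁, hcore₁, -⟩ := ScheduleNP.appendNP_right ((R.scheduleN a hσ c hR heb).toNPρ P₁.ρ) (P₁.scheduleNP (oth a) hσ c₁ hP₁ heb₁) hea₁ rfl hj₁ j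
  refine ⟨?_, ?_, fun i => ?_, ?_⟩
  · show ((corrSchedNP₁₂ R P₁ a hσ c c₁ hR heb hP₁ heb₁ hea₁ hj₁).appendNP (P₂.scheduleNP a hσ c₂ hP₂ heb₂) hea₂ hρ (corrSchedNP₁₂_join R P₁ P₂ a hσ c c₁ c₂ hR heb hP₁ heb₁ hP₂ heb₂ hea₁ hj₁ hj₂)).ax (R.N + 1 + j) = _; rw [hax]; exact hax₁
  · show ((corrSchedNP₁₂ R P₁ a hσ c c₁ hR heb hP₁ heb₁ hea₁ hj₁).appendNP (P₂.scheduleNP a hσ c₂ hP₂ heb₂) hea₂ hρ (corrSchedNP₁₂_join R P₁ P₂ a hσ c c₁ c₂ hR heb hP₁ heb₁ hP₂ heb₂ hea₁ hj₁ hj₂)).region (R.N + 1 + j) = _; rw [hreg]; exact hreg₁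
  · show ((corrSchedNP₁₂ R P₁ a hσ c c₁ hR heb hP₁ heb₁ hea₁ hj₁).appendNP (P₂.scheduleNP a hσ c₂ hP₂ heb₂) hea₂ hρ (corrSchedNP₁₂_join R P₁ P₂ a hσ c c₁ c₂ hR heb hP₁ heb₁ hP₂ heb₂ hea₁ hj₁ hj₂)).level (R.N + 1 + j) i = _; rw [hlev i]; exact hlev₁ i
  · show ((corrSchedNP₁₂ R P₁ a hσ c c₁ hR heb hP₁ heb₁ hea₁ hj₁).appendNP (P₂.scheduleNP a hσ c₂ hP₂ heb₂) hea₂ hρ (corrSchedNP₁₂_join R P₁ P₂ a hσ c c₁ c₂ hR heb hP₁ heb₁ hP₂ heb₂ hea₁ hj₁ hj₂)).core (R.N + 1 + j) = _; rw [hcore]; exact hcore₁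

/-- **Along-parking phase** (step `N_R + 1 + N₁ + 1 + j`): axis `a`, `P₂`'s region, levels and core at `j`. [folklore] -/
theorem corrSchedNP_park₂ (j : ℕ) :
    (corrSchedNP R P₁ P₂ a hσ c c₁ c₂ hR heb hP₁ heb₁ hP₂ heb₂ hea₁ hea₂ hρ hj₁ hj₂).ax (R.N + 1 + P₁.N + 1 + j) = a ∧
    (corrSchedNP R P₁ P₂ a hσ c c₁ c₂ hR heb hP₁ heb₁ hP₂ heb₂ hea₁ hea₂ hρ hj₁ hj₂).region (R.N + 1 + P₁.N + 1 + j) = P₂.pregion a σ c₂ j ∧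
    (∀ i, (corrSchedNP R P₁ P₂ a hσ c c₁ c₂ hR heb hP₁ heb₁ hP₂ heb₂ hea₁ hea₂ hρ hj₁ hj₂).level (R.N + 1 + P₁.N + 1 + j) i =
      (P₂.scheduleNP a hσ c₂ hP₂ heb₂).level j i) ∧
    (corrSchedNP R P₁ P₂ a hσ c c₁ c₂ hR heb hP₁ heb₁ hP₂ heb₂ hea₁ hea₂ hρ hj₁ hj₂).core (R.N + 1 + P₁.N + 1 + j) = P₂.pcore a σ c₂ j := by
  obtain ⟨hax, hreg, hlev, hcore, -⟩ := ScheduleNP.appendNP_right (corrSchedNP₁₂ R P₁ a hσ c c₁ hR heb hP₁ heb₁ hea₁ hj₁) (P₂.scheduleNP a hσ c₂ hP₂ heb₂) hea₂ hρ (corrSchedNP₁₂_join R P₁ P₂ a hσ c c₁ c₂ hR heb hP₁ heb₁ hP₂ heb₂ hea₁ hj₁ hj₂) j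
  exact ⟨hax, hreg, hlev, hcore⟩

/-- **The first core is the run's start box.** [folklore] -/
theorem corrSchedNP_core_zero :
    (corrSchedNP R P₁ P₂ a hσ c c₁ c₂ hR heb hP₁ heb₁ hP₂ heb₂ hea₁ hea₂ hρ hj₁ hj₂).core 0 = (R.scheduleN a hσ c hR heb).core 0 :=
  (corrSchedNP_run R P₁ P₂ a hσ c c₁ c₂ hR heb hP₁ heb₁ hP₂ heb₂ hea₁ hea₂ hρ hj₁ hj₂ (Nat.zero_le _)).2.2.2

/-- Membership in the first core: `|σ(y_a − c_a)| ≤ q`, `−Wm ≤ σ(y_{a′} − c_{a′}) ≤ Wp`. [folklore] -/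
theorem mem_corrSchedNP_core_zero {y : Site 2} :
    y ∈ (corrSchedNP R P₁ P₂ a hσ c c₁ c₂ hR heb hP₁ heb₁ hP₂ heb₂ hea₁ hea₂ hρ hj₁ hj₂).core 0 ↔
      (-(R.q : ℤ) ≤ σ * (y a - c a) ∧ σ * (y a - c a) ≤ R.q) ∧
        (-(R.Wm : ℤ) ≤ σ * (y (oth a) - c (oth a)) ∧ σ * (y (oth a) - c (oth a)) ≤ R.Wp) := by
  rw [corrSchedNP_core_zero, RunPrm.mem_scheduleN_core_zero]

/-- **The last core is the along-parking's last core.** [folklore] -/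
theorem corrSchedNP_core_last :
    (corrSchedNP R P₁ P₂ a hσ c c₁ c₂ hR heb hP₁ heb₁ hP₂ heb₂ hea₁ hea₂ hρ hj₁ hj₂).core
        ((corrSchedNP R P₁ P₂ a hσ c c₁ c₂ hR heb hP₁ heb₁ hP₂ heb₂ hea₁ hea₂ hρ hj₁ hj₂).N + 1) = P₂.pcore a σ c₂ (P₂.N + 1) :=
  ScheduleNP.appendNP_core_last (corrSchedNP₁₂ R P₁ a hσ c c₁ hR heb hP₁ heb₁ hea₁ hj₁) (P₂.scheduleNP a hσ c₂ hP₂ heb₂) hea₂ hρ (corrSchedNP₁₂_join R P₁ P₂ a hσ c c₁ c₂ hR heb hP₁ heb₁ hP₂ heb₂ hea₁ hj₁ hj₂)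

/-- Membership in the last core, in along-parking coordinates. [folklore] -/
theorem mem_corrSchedNP_core_last {y : Site 2} :
    y ∈ (corrSchedNP R P₁ P₂ a hσ c c₁ c₂ hR heb hP₁ heb₁ hP₂ heb₂ hea₁ hea₂ hρ hj₁ hj₂).core
        ((corrSchedNP R P₁ P₂ a hσ c c₁ c₂ hR heb hP₁ heb₁ hP₂ heb₂ hea₁ hea₂ hρ hj₁ hj₂).N + 1) ↔
      P₂.InCore (P₂.N + 1) (σ * (y a - c₂ a)) (σ * (y (oth a) - c₂ (oth a))) := by
  rw [corrSchedNP_core_last, ParkPrm.mem_pcore_iff hσ]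

/-- Every region of the corridor lies in the union of the three rendered prisms. [folklore] -/
theorem corrSchedNP_region_subset {k : ℕ} (hk : k ≤ (corrSchedNP R P₁ P₂ a hσ c c₁ c₂ hR heb hP₁ heb₁ hP₂ heb₂ hea₁ hea₂ hρ hj₁ hj₂).N) :
    (corrSchedNP R P₁ P₂ a hσ c c₁ c₂ hR heb hP₁ heb₁ hP₂ heb₂ hea₁ hea₂ hρ hj₁ hj₂).region k ⊆
      R.pprism a σ c ∪ P₁.pprism (oth a) σ c₁ ∪ P₂.pprism a σ c₂ :=
  (corrSchedNP R P₁ P₂ a hσ c c₁ c₂ hR heb hP₁ heb₁ hP₂ heb₂ hea₁ hea₂ hρ hj₁ hj₂).sub_prism k hk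

/-! ## §4 Where the corridor ends -/

/-- **THE LAST CORE LIES IN AN EXPLICIT BOX**: after the along-parking's `N₂ + 1` steps with
`A₂ − aLo0₂ ≤ sHi₂ + ρ − 1 + (N₂+1)·(sLo₂ − 2ea₂ − ρ)` (parked), every point `y` of the last core has
`aHi₂(N₂+1) − (sHi₂ + ρ − 1) ≤ σ(y_a − c₂_a) ≤ aHi₂(N₂+1)` (`aHi₂ k = A₂ + k(ea₂ + ρ)`) and
`−Wm₂ − (N₂+1)·g₂ ≤ σ(y_{a′} − c₂_{a′}) ≤ Wp₂ + (N₂+1)·g₂` (`g₂ = eb₂ + ρ + |d₂|`). [this work] -/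
theorem corrSchedNP_core_last_subset
    (hpark : P₂.A - P₂.aLo0 ≤ P₂.sHi + P₂.ρ - 1 + ((P₂.N + 1 : ℕ) : ℤ) * (P₂.sLo - 2 * P₂.ea - P₂.ρ)) {y : Site 2}
    (hy : y ∈ (corrSchedNP R P₁ P₂ a hσ c c₁ c₂ hR heb hP₁ heb₁ hP₂ heb₂ hea₁ hea₂ hρ hj₁ hj₂).core
        ((corrSchedNP R P₁ P₂ a hσ c c₁ c₂ hR heb hP₁ heb₁ hP₂ heb₂ hea₁ hea₂ hρ hj₁ hj₂).N + 1)) :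
    (P₂.A + ((P₂.N + 1 : ℕ) : ℤ) * (P₂.ea + P₂.ρ) - (P₂.sHi + P₂.ρ - 1) ≤ σ * (y a - c₂ a) ∧
      σ * (y a - c₂ a) ≤ P₂.A + ((P₂.N + 1 : ℕ) : ℤ) * (P₂.ea + P₂.ρ)) ∧
    (-(P₂.Wm : ℤ) - ((P₂.N + 1 : ℕ) : ℤ) * P₂.g ≤ σ * (y (oth a) - c₂ (oth a)) ∧
      σ * (y (oth a) - c₂ (oth a)) ≤ P₂.Wp + ((P₂.N + 1 : ℕ) : ℤ) * P₂.g) := by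
  rw [mem_corrSchedNP_core_last] at hy
  obtain ⟨h1, h2, h3, h4⟩ := hy
  have hext := ParkPrm.extent_le_of_steps hP₂ hpark
  have eHi : P₂.aHi (P₂.N + 1) = P₂.A + ((P₂.N + 1 : ℕ) : ℤ) * (P₂.ea + P₂.ρ) := rfl
  have eLo : P₂.bLo (P₂.N + 1) = -(P₂.Wm : ℤ) - ((P₂.N + 1 : ℕ) : ℤ) * P₂.g := rfl
  have eHi' : P₂.bHi (P₂.N + 1) = (P₂.Wp : ℤ) + ((P₂.N + 1 : ℕ) : ℤ) * P₂.g := rfl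
  refine ⟨⟨by linarith, by linarith⟩, by linarith, by linarith⟩

end Corridor

end ChainPara

end Transplant

end Summit.CriticalPhenomena.PercolationContinuityZ3.Theorems

end
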